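import Literature.MathematicalPhysics.QuantumFieldTheory.Balaban1983to89.Node00.TorusCoverGaugeTokensRPrint
import Literature.MathematicalPhysics.QuantumFieldTheory.Balaban1983to89.Node00.CriticalOnFibreTopFloor

/-!
# NODE 00 — THE (9)-STEP COMPOSITIONS FROM THE FLOOR-CARRYING STUB-1 FACT: `Gauge9RegSepTopStepR(10) … M c …` ⟸ `Prop8RegSepTopStepR … c₈ …` (`c₈ ≤ c`) ∧ the (152) token at
# floor `c`; at print's cubes the floor letter becomes `max c₈ ((11·4 + 4ρ)·L)` (module 36c's `gauge9RP_of_prop8TopStep_of_prop6P(_of_one_le)` with stub 1 floor-carrying)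

Cell `pub-ymgap` (HUMAN RULINGS D-0062 ∕ D-0088), seat `pub-ymgap-dag-n07-e` g20 (R141 (C) row s3 lineage; DAG node N07 = [B11]; lane owner; declarer of FILE 29 ∕ 34c ∕ 36c ∕ 46), 2026-08-28.
`--kind proof --supports stmt-QuantumFields-20541` (K0⁷; count-neutral).  Sequel «36c-R» of module 46 `Node00/CriticalOnFibreTopFloor` (p620435) named in LOCATED-STUB1-FLOOR (cell bus
2026-08-28 08:50Z; head's ANSWER 09:09Z «the floor is NEEDED at STEP 7 — CONFIRMED»).  THEOREMS ONLY (0 `def`, 0 `sorry`); additive — nothing landed is edited.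

THE PRINT.  [B11] = T. Bałaban, CMP **102** (1985) 277–309 `[Balaban1985Variational]`: Thm 1 (8)–(10) p. 279; Sect. F pp. 300–305 derives (9)–(10) on the cubes of (144) (collars
`R₁M₁`, p. 300) from (8) (Prop. 8 p. 304) and [6] = CMP **99** (1985) `[Balaban1985RegularSpaces]` Thm 2 ∕ Prop. 6 (p. 99, p. 98: cubes at big-block size); p. 304 lines 1–2 *«We may
assume that R₁M₁ is sufficiently big»* — print's Prop. 8 AND its (9)-step both live above a floor on the numerics.  On the tree, FILE 29 ∕ 34c ∕ 36c composed the FLOOR-FREE stub-1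
fact `Prop8RegSepTopStep` with the floor-carrying (152) token; once stub 1 is read floor-carrying (`Prop8RegSepTopStepR … c₈ …`, module 46) the composition needs `c₈` UNDER the
token's floor `c` — the reduction is pointwise in the prefix `(ν, g, K, k, s)`, where the (9)-token's own binder `c ≤ ν.M₁` supplies `c₈ ≤ ν.M₁`.

WHAT IS PROVED (sorry-free; no definition; axioms standard).
* §1 `Gauge9RegSepTopStepR10.of_le ∕ .mono_floor` (34c's token: the two monotonicities FILE 29 recorded for the three-letter token), ★ `gauge9R_of_prop8TopStepR_of_gauge152R`,
  ★ `gauge9R10_of_prop8TopStepR_of_gauge152R10` (`h8 : Prop8RegSepTopStepR … c₈ …`, `hc₈ : c₈ ≤ c`, the token at floor `c` ⟹ the (9)-token at floor `c`; FILE 29 ∕ 34c's proofs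
  with `(hc₈.trans hc)` in the one place `h8` is applied), and the HalvingStep-sourced forms ★ `gauge9R(10)_of_halvingStepTopR_of_gauge152R(10)` (module 46 §4's equivalence).
* §2 at print's cubes: ★★ `gauge9R10P_of_prop8TopStepR_of_prop6P`, ★★ `gauge9RP_of_prop8TopStepR_of_prop6P` (`ρ ≥ L`; floor `max c₈ ((11·4 + 4ρ)·L)`), ★★
  `gauge9R10P_of_prop8TopStepR_of_prop6P_of_one_le`, ★★ `gauge9RP_of_prop8TopStepR_of_prop6P_of_one_le` (stub 2′'s bare `ρ₀ ≥ 1`, `ρ := ρ₀·L`; floor `max c₈ ((11·4 + 4·(ρ₀L))·L)`) —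
  36c's four compositions with stub 1 floor-carrying; the (152) token is lifted to the common floor by `Gauge152OfClassTopStepR(10).mono_floor`.
* §3 sanity: at `c₈ = 0` §2 IS 36c (`gauge9RP_of_prop8TopStepR_zero_of_prop6P_of_one_le`, via `prop8RegSepTopStepR_zero_iff` and `max 0 c = c`).
NOT HERE: the K0-side consumers at the new floor letter (dag-n21-c's PART 1∕2 pick the witness index `j` with `max c₈ (c(ρ₀)) ≤ L^j` — their pen), the V20 skeleton text (plan).
HONEST SCOPE.  Binder-threading bookkeeping BY NAME; nothing of [B11] ∕ [6] asserted; the antecedents (stub 1 in either reading, Prop. 6 on print's class) are OPEN and NOT inhabited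
here; `stub_prop8StepCoP13` ∕ K0⁷ NOT closed; N07 NOT discharged; counts unmoved (28∕28 · 5∕27); one finite 𝕋⁴ programme at fixed ε — the route closes the conditional finite-𝕋⁴ rung
`BalabanLadder.UV` only; nothing continuum ∕ ℝ⁴ ∕ OS ∕ mass gap ∕ Clay.  No `sorry`, no `def`, no `instance`, no `notation`.

References: [B11] Thm 1 (8)–(10) p.279, (144)–(152) pp.300–301, p.304; [6] Prop. 6 p.99, p.98, (1.3)–(1.6) p.77; [Balaban1988Convergent] (2.13) p.256.
-/

noncomputable section

namespace Literature.MathematicalPhysics.QuantumFieldTheory.Balaban1983to89.Node00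

open scoped Matrix.Norms.L2Operator
open T4Continuum (T4Family)
open B15DeterminingSets B12RegularSpaces111
open B8LeafModelZd (ZdIdx)

/-! ## §1  The reductions with stub 1 floor-carrying -/

section Tokens

variable {F : T4Family} {N : ℕ} [NeZero N]

/-- 34c's four-letter (9)-token is ANTITONE in the ceilings `a₀ a₁`. [cite: Balaban1985Variational, Thm 1 (9)–(10) p.279 (bookkeeping)] -/
theorem Gauge9RegSepTopStepR10.of_le {Sup : (ν : Stage7Numerics) → (K : ℕ) → (ℕ → Set (Site (F.P K) 0)) → Set (Site (F.P K) 0)} {M c : ℕ}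
    {B₃ B₃' a₀ a₀' a₁ a₁' : ℝ} (h : Gauge9RegSepTopStepR10 F N Sup M c B₃ B₃' a₀ a₁) (ha₀ : a₀' ≤ a₀) (ha₁ : a₁' ≤ a₁) :
    Gauge9RegSepTopStepR10 F N Sup M c B₃ B₃' a₀' a₁' :=
  fun ν g K k s hsep hM₁ hc hk ε₀ δ hδ hcomp hcomp' hε₀ =>
    h ν g K k s hsep hM₁ hc hk ε₀ δ (fun n hn => ⟨(hδ n hn).1, (hδ n hn).2.1.trans ha₁, (hδ n hn).2.2⟩) hcomp hcomp' (hε₀.trans ha₀)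

/-- 34c's four-letter (9)-token is MONOTONE in the floor. [cite: Balaban1985RegularSpaces, (1.3)–(1.6) p.77 (bookkeeping)] -/
theorem Gauge9RegSepTopStepR10.mono_floor {Sup : (ν : Stage7Numerics) → (K : ℕ) → (ℕ → Set (Site (F.P K) 0)) → Set (Site (F.P K) 0)} {M c c' : ℕ}
    {B₃ B₃' a₀ a₁ : ℝ} (h : Gauge9RegSepTopStepR10 F N Sup M c B₃ B₃' a₀ a₁) (hcc : c ≤ c') : Gauge9RegSepTopStepR10 F N Sup M c' B₃ B₃' a₀ a₁ :=
  fun ν g K k s hsep hM₁ hc' hk => h ν g K k s hsep hM₁ (hcc.trans hc') hk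

/-- ★ **THE (9)-REDUCTION WITH STUB 1 FLOOR-CARRYING** (FILE 29's `gauge9R_of_prop8TopStep_of_gauge152R`, verbatim otherwise): the floor-carrying top step at floor `c₈ ≤ c` and the
(152) token at floor `c` give the three-letter (9)-token at floor `c` — apply the token at the radii `B₃δ_•` of (8); the (9)-token's own binder `c ≤ ν.M₁` feeds stub 1's floor.
[cite: Balaban1985Variational, Sect. F pp.300–305, Prop. 8 p.304, (152) p.301, Thm 1 (8)–(9) p.279; Balaban1985RegularSpaces, (1.3)–(1.6) p.77] -/
theorem gauge9R_of_prop8TopStepR_of_gauge152R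
    {Sup : (ν : Stage7Numerics) → (K : ℕ) → (ℕ → Set (Site (F.P K) 0)) → Set (Site (F.P K) 0)} {M c₈ c : ℕ} {B₃ B₉ a₀ a₀' a₁ : ℝ}
    (h8 : Prop8RegSepTopStepR F N Sup c₈ B₃ a₀ a₁) (hc₈ : c₈ ≤ c) (h152 : Gauge152OfClassTopStepR F N Sup M c B₉ a₀') (hB₃ : 0 < B₃)
    (ha : B₃ * a₁ ≤ a₀') : Gauge9RegSepTopStepR F N Sup M c B₃ (B₉ * B₃) a₀ a₁ := by
  intro ν g K k s hsep hM₁ hc hk ε₀ δ hδ hcomp hcomp' hε₀ W h7 U h17 h19 hfib hcrit n hn1 hnk S hS hSN a ha' hΩ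
  obtain ⟨h8p, h8c⟩ := h8 ν M g K k s hsep hM₁ (hc₈.trans hc) hk ε₀ δ hδ hcomp hcomp' hε₀ W h7 U h17 h19 hfib hcrit
  have hε : ∀ m, m ≤ k → 0 < B₃ * δ m ∧ B₃ * δ m ≤ a₀' := fun m hm =>
    ⟨mul_pos hB₃ (hδ m hm).1, (mul_le_mul_of_nonneg_left (hδ m hm).2.1 hB₃.le).trans ha⟩
  have hc1 : ∀ m, m < k → B₃ * δ m ≤ 2 * (B₃ * δ (m + 1)) := fun m hm => by
    have := mul_le_mul_of_nonneg_left (hcomp m hm) hB₃.le; linarith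
  have hc2 : ∀ m, m < k → B₃ * δ (m + 1) ≤ 2 * (B₃ * δ m) := fun m hm => by
    have := mul_le_mul_of_nonneg_left (hcomp' m hm) hB₃.le; linarith
  obtain ⟨u, A, hexp, hA, hgrad⟩ := h152 ν g K k s hsep hM₁ hc hk (fun m => B₃ * δ m) hε hc1 hc2 U h8p h8c n hn1 hnk S hS hSN a ha' hΩ
  refine ⟨u, A, hexp, fun b hb => ?_, fun q hq => ?_⟩
  · calc ‖A b‖ < B₉ * (B₃ * δ n) := hA b hb
      _ = B₉ * B₃ * δ n := by ring
  · calc ‖grad ((F.P K).eta n) q.2.1 (fun y => A ⟨y, q.2.2⟩) q.1‖ < B₉ * (B₃ * δ n) := hgrad q hq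
      _ = B₉ * B₃ * δ n := by ring

/-- ★ **THE (9)–(10)-REDUCTION WITH STUB 1 FLOOR-CARRYING** (34c's `gauge9R10_of_prop8TopStep_of_gauge152R10`, verbatim otherwise): floor `c₈ ≤ c` of the top step, the four-letter
(152) token at floor `c` ⟹ the four-letter (9)-token at floor `c`. [cite: Balaban1985Variational, Sect. F pp.300–305, Prop. 8 p.304, (152) p.301, Thm 1 (8)–(10) p.279; Balaban1985RegularSpaces, (1.3)–(1.6) p.77] -/
theorem gauge9R10_of_prop8TopStepR_of_gauge152R10
    {Sup : (ν : Stage7Numerics) → (K : ℕ) → (ℕ → Set (Site (F.P K) 0)) → Set (Site (F.P K) 0)} {M c₈ c : ℕ} {B₃ B₉ a₀ a₀' a₁ : ℝ}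
    (h8 : Prop8RegSepTopStepR F N Sup c₈ B₃ a₀ a₁) (hc₈ : c₈ ≤ c) (h152 : Gauge152OfClassTopStepR10 F N Sup M c B₉ a₀') (hB₃ : 0 < B₃)
    (ha : B₃ * a₁ ≤ a₀') : Gauge9RegSepTopStepR10 F N Sup M c B₃ (B₉ * B₃) a₀ a₁ := by
  intro ν g K k s hsep hM₁ hc hk ε₀ δ hδ hcomp hcomp' hε₀ W h7 U h17 h19 hfib hcrit n hn1 hnk S hS hSN a ha' hΩ
  obtain ⟨h8p, h8c⟩ := h8 ν M g K k s hsep hM₁ (hc₈.trans hc) hk ε₀ δ hδ hcomp hcomp' hε₀ W h7 U h17 h19 hfib hcrit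
  have hε : ∀ m, m ≤ k → 0 < B₃ * δ m ∧ B₃ * δ m ≤ a₀' := fun m hm =>
    ⟨mul_pos hB₃ (hδ m hm).1, (mul_le_mul_of_nonneg_left (hδ m hm).2.1 hB₃.le).trans ha⟩
  have hc1 : ∀ m, m < k → B₃ * δ m ≤ 2 * (B₃ * δ (m + 1)) := fun m hm => by
    have := mul_le_mul_of_nonneg_left (hcomp m hm) hB₃.le; linarith
  have hc2 : ∀ m, m < k → B₃ * δ (m + 1) ≤ 2 * (B₃ * δ m) := fun m hm => by
    have := mul_le_mul_of_nonneg_left (hcomp' m hm) hB₃.le; linarith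
  have h := h152 ν g K k s hsep hM₁ hc hk (fun m => B₃ * δ m) hε hc1 hc2 U h8p h8c n hn1 hnk S hS hSN a ha' hΩ
  rw [show B₉ * B₃ * δ n = B₉ * (B₃ * δ n) by ring]
  exact h

/-- ★ The (9)-reduction sourced from the floor-carrying ONE-STEP fact (module 46 §4: `HalvingStepTopR c₈ ⇔ Prop8RegSepTopStepR c₈` at `0 < B₃`).
[cite: Balaban1985Variational, Sect. F pp.300–305, Thm 1 (8)–(9) p.279 (bookkeeping)] -/
theorem gauge9R_of_halvingStepTopR_of_gauge152R
    {Sup : (ν : Stage7Numerics) → (K : ℕ) → (ℕ → Set (Site (F.P K) 0)) → Set (Site (F.P K) 0)} {M c₈ c : ℕ} {B₃ B₉ a₀ a₀' a₁ : ℝ}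
    (hH : HalvingStepTopR F N Sup c₈ B₃ a₀ a₁) (hc₈ : c₈ ≤ c) (h152 : Gauge152OfClassTopStepR F N Sup M c B₉ a₀') (hB₃ : 0 < B₃)
    (ha : B₃ * a₁ ≤ a₀') : Gauge9RegSepTopStepR F N Sup M c B₃ (B₉ * B₃) a₀ a₁ :=
  gauge9R_of_prop8TopStepR_of_gauge152R (prop8RegSepTopStepR_of_halvingStepTopR hB₃ hH) hc₈ h152 hB₃ ha

/-- ★ The (9)–(10)-reduction sourced from the floor-carrying ONE-STEP fact. [cite: Balaban1985Variational, Sect. F pp.300–305, Thm 1 (8)–(10) p.279 (bookkeeping)] -/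
theorem gauge9R10_of_halvingStepTopR_of_gauge152R10
    {Sup : (ν : Stage7Numerics) → (K : ℕ) → (ℕ → Set (Site (F.P K) 0)) → Set (Site (F.P K) 0)} {M c₈ c : ℕ} {B₃ B₉ a₀ a₀' a₁ : ℝ}
    (hH : HalvingStepTopR F N Sup c₈ B₃ a₀ a₁) (hc₈ : c₈ ≤ c) (h152 : Gauge152OfClassTopStepR10 F N Sup M c B₉ a₀') (hB₃ : 0 < B₃)
    (ha : B₃ * a₁ ≤ a₀') : Gauge9RegSepTopStepR10 F N Sup M c B₃ (B₉ * B₃) a₀ a₁ :=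
  gauge9R10_of_prop8TopStepR_of_gauge152R10 (prop8RegSepTopStepR_of_halvingStepTopR hB₃ hH) hc₈ h152 hB₃ ha

end Tokens

/-! ## §2  ★★ At print's cubes: 36c's four compositions with stub 1 floor-carrying (floor letter `max c₈ ((11·4 + 4ρ)·L)`) -/

section NineStep

variable {F : T4Family} {N : ℕ} [NeZero N]

/-- ★★ **[15] THM 1 (9)–(10) FOR CRITICAL CONFIGURATIONS ⟸ PROP. 8's TOP STEP AT FLOOR `c₈` ∧ [6] PROP. 6 ON PRINT'S CLASS** (`ρ ≥ L`): the four-letter (9)-token at the floor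
`max c₈ ((11·4 + 4ρ)·L)`, constants `b9OfP·B₃`, once `0 < B₃` and `B₃a₁ ≤ a0OfP F N M ρ B₁ c₁`. [cite: Balaban1985Variational, Thm 1 (8)–(10) p.279, Prop. 8 p.304, (152) p.301; Balaban1985RegularSpaces, Prop. 6 p.99, p.98] -/
theorem gauge9R10P_of_prop8TopStepR_of_prop6P {c₈ : ℕ} {B₃ a₀ a₁ B₁ c₁ : ℝ}
    (h8 : Prop8RegSepTopStepR F N (fun ν K Ω => suppDomOfRecord F ν K Ω) c₈ B₃ a₀ a₁) (hB₁ : 0 ≤ B₁) (hc₁ : 0 < c₁) {ρ : ℕ} (hρ : F.L ≤ ρ)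
    (hP6 : letI : CStarAlgebra (MatA N) := {}; B8.Prop6Printed 4 (F.L : ℝ) B₁ c₁ (fun i : ZdIdx 4 F.L => zdCubP (MatA N) F.L ρ i)) (M : ℕ)
    (hB₃ : 0 < B₃) (ha : B₃ * a₁ ≤ a0OfP F N M ρ B₁ c₁) :
    Gauge9RegSepTopStepR10 F N (fun ν K Ω => suppDomOfRecord F ν K Ω) M (max c₈ ((11 * 4 + 4 * ρ) * F.L)) B₃ (b9OfP F M ρ B₁ * B₃) a₀ a₁ :=
  gauge9R10_of_prop8TopStepR_of_gauge152R10 h8 (le_max_left _ _) ((gauge152R10P_of_prop6 hB₁ hc₁ hρ hP6 M).mono_floor (le_max_right _ _)) hB₃ ha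

/-- ★★ **THE THREE-LETTER (9)-TOKEN ⟸ PROP. 8's TOP STEP AT FLOOR `c₈` ∧ PROP. 6 ON PRINT'S CLASS** (`ρ ≥ L`; floor `max c₈ ((11·4 + 4ρ)·L)`).
[cite: Balaban1985Variational, Thm 1 (8)–(9) p.279, Prop. 8 p.304, (152) p.301; Balaban1985RegularSpaces, Prop. 6 p.99, p.98] -/
theorem gauge9RP_of_prop8TopStepR_of_prop6P {c₈ : ℕ} {B₃ a₀ a₁ B₁ c₁ : ℝ}
    (h8 : Prop8RegSepTopStepR F N (fun ν K Ω => suppDomOfRecord F ν K Ω) c₈ B₃ a₀ a₁) (hB₁ : 0 ≤ B₁) (hc₁ : 0 < c₁) {ρ : ℕ} (hρ : F.L ≤ ρ)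
    (hP6 : letI : CStarAlgebra (MatA N) := {}; B8.Prop6Printed 4 (F.L : ℝ) B₁ c₁ (fun i : ZdIdx 4 F.L => zdCubP (MatA N) F.L ρ i)) (M : ℕ)
    (hB₃ : 0 < B₃) (ha : B₃ * a₁ ≤ a0OfP F N M ρ B₁ c₁) :
    Gauge9RegSepTopStepR F N (fun ν K Ω => suppDomOfRecord F ν K Ω) M (max c₈ ((11 * 4 + 4 * ρ) * F.L)) B₃ (b9OfP F M ρ B₁ * B₃) a₀ a₁ :=
  gauge9R_of_prop8TopStepR_of_gauge152R h8 (le_max_left _ _) ((gauge152RP_of_prop6 hB₁ hc₁ hρ hP6 M).mono_floor (le_max_right _ _)) hB₃ ha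

/-- ★★ **THE FOUR-LETTER (9)-TOKEN AT STUB 2′'s BARE `ρ₀ ≥ 1`** (`ρ := ρ₀·L`; floor `max c₈ ((11·4 + 4·(ρ₀L))·L)`). [cite: Balaban1985Variational, Thm 1 (8)–(10) p.279, Prop. 8 p.304; Balaban1985RegularSpaces, Prop. 6 p.99, p.98] -/
theorem gauge9R10P_of_prop8TopStepR_of_prop6P_of_one_le {c₈ : ℕ} {B₃ a₀ a₁ B₁ c₁ : ℝ}
    (h8 : Prop8RegSepTopStepR F N (fun ν K Ω => suppDomOfRecord F ν K Ω) c₈ B₃ a₀ a₁) (hB₁ : 0 ≤ B₁) (hc₁ : 0 < c₁) {ρ₀ : ℕ} (hρ₀ : 1 ≤ ρ₀)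
    (hP6 : letI : CStarAlgebra (MatA N) := {}; B8.Prop6Printed 4 (F.L : ℝ) B₁ c₁ (fun i : ZdIdx 4 F.L => zdCubP (MatA N) F.L ρ₀ i)) (M : ℕ)
    (hB₃ : 0 < B₃) (ha : B₃ * a₁ ≤ a0OfP F N M (ρ₀ * F.L) B₁ c₁) :
    Gauge9RegSepTopStepR10 F N (fun ν K Ω => suppDomOfRecord F ν K Ω) M (max c₈ ((11 * 4 + 4 * (ρ₀ * F.L)) * F.L)) B₃
      (b9OfP F M (ρ₀ * F.L) B₁ * B₃) a₀ a₁ :=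
  gauge9R10_of_prop8TopStepR_of_gauge152R10 h8 (le_max_left _ _) ((gauge152R10P_of_prop6_of_one_le hB₁ hc₁ hρ₀ hP6 M).mono_floor (le_max_right _ _))
    hB₃ ha

/-- ★★ **THE THREE-LETTER (9)-TOKEN AT STUB 2′'s BARE `ρ₀ ≥ 1`** (`ρ := ρ₀·L`; floor `max c₈ ((11·4 + 4·(ρ₀L))·L)`) — 36c's `gauge9RP_of_prop8TopStep_of_prop6P_of_one_le` (the K0 road's
supplier, dag-n21-c PART 2) with stub 1 floor-carrying. [cite: Balaban1985Variational, Thm 1 (8)–(9) p.279, Prop. 8 p.304; Balaban1985RegularSpaces, Prop. 6 p.99, p.98] -/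
theorem gauge9RP_of_prop8TopStepR_of_prop6P_of_one_le {c₈ : ℕ} {B₃ a₀ a₁ B₁ c₁ : ℝ}
    (h8 : Prop8RegSepTopStepR F N (fun ν K Ω => suppDomOfRecord F ν K Ω) c₈ B₃ a₀ a₁) (hB₁ : 0 ≤ B₁) (hc₁ : 0 < c₁) {ρ₀ : ℕ} (hρ₀ : 1 ≤ ρ₀)
    (hP6 : letI : CStarAlgebra (MatA N) := {}; B8.Prop6Printed 4 (F.L : ℝ) B₁ c₁ (fun i : ZdIdx 4 F.L => zdCubP (MatA N) F.L ρ₀ i)) (M : ℕ)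
    (hB₃ : 0 < B₃) (ha : B₃ * a₁ ≤ a0OfP F N M (ρ₀ * F.L) B₁ c₁) :
    Gauge9RegSepTopStepR F N (fun ν K Ω => suppDomOfRecord F ν K Ω) M (max c₈ ((11 * 4 + 4 * (ρ₀ * F.L)) * F.L)) B₃
      (b9OfP F M (ρ₀ * F.L) B₁ * B₃) a₀ a₁ :=
  gauge9R_of_prop8TopStepR_of_gauge152R h8 (le_max_left _ _) ((gauge152RP_of_prop6_of_one_le hB₁ hc₁ hρ₀ hP6 M).mono_floor (le_max_right _ _)) hB₃ ha

end NineStep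

/-! ## §3  Sanity: at floor `c₈ = 0` §2 IS module 36c -/

section Sanity

variable {F : T4Family} {N : ℕ} [NeZero N]

/-- At `c₈ = 0` (the floor-free stub-1 fact, module 46's `prop8RegSepTopStepR_zero_iff`) §2's token has 36c's floor letter `(11·4 + 4·(ρ₀L))·L` (`max 0 c = c`).
[cite: Balaban1985Variational, Thm 1 (8)–(9) p.279, Prop. 8 p.304 (bookkeeping)] -/
theorem gauge9RP_of_prop8TopStepR_zero_of_prop6P_of_one_le {B₃ a₀ a₁ B₁ c₁ : ℝ}
    (h8 : Prop8RegSepTopStep F N (fun ν K Ω => suppDomOfRecord F ν K Ω) B₃ a₀ a₁) (hB₁ : 0 ≤ B₁) (hc₁ : 0 < c₁) {ρ₀ : ℕ} (hρ₀ : 1 ≤ ρ₀)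
    (hP6 : letI : CStarAlgebra (MatA N) := {}; B8.Prop6Printed 4 (F.L : ℝ) B₁ c₁ (fun i : ZdIdx 4 F.L => zdCubP (MatA N) F.L ρ₀ i)) (M : ℕ)
    (hB₃ : 0 < B₃) (ha : B₃ * a₁ ≤ a0OfP F N M (ρ₀ * F.L) B₁ c₁) :
    Gauge9RegSepTopStepR F N (fun ν K Ω => suppDomOfRecord F ν K Ω) M ((11 * 4 + 4 * (ρ₀ * F.L)) * F.L) B₃ (b9OfP F M (ρ₀ * F.L) B₁ * B₃) a₀ a₁ := by
  have h := gauge9RP_of_prop8TopStepR_of_prop6P_of_one_le (prop8RegSepTopStepR_zero_iff.2 h8) hB₁ hc₁ hρ₀ hP6 M hB₃ ha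
  rwa [Nat.zero_max] at h

end Sanity

end Literature.MathematicalPhysics.QuantumFieldTheory.Balaban1983to89.Node00

end
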